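import Mathlib.Geometry.Manifold.SmoothEmbedding
import Mathlib.Geometry.Manifold.Instances.Real
import Mathlib.Analysis.Convex.Topology
import Mathlib.Analysis.InnerProductSpace.PiL2
import HarnessLib

/-!
# The two local sides of a smoothly embedded hypersurface

For a smooth embedding `f : S → X` of an `n`-manifold into an `(n+1)`-manifold (models `𝓡 n`,
`𝓡 (n+1)`) every point `f z₀` has an open neighbourhood `O` in which the complement of
`range f` is covered by two preconnected sets `H₁, H₂ ⊆ (range f)ᶜ`, each having every point
of `range f ∩ O` in its closure (`exists_local_sides`).  In the slice charts of Mathlib's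
immersion data at `z₀` (`Manifold.IsImmersionAt`: `f` reads `u ↦ equiv (u, 0)`), straightened by
an identification of the one-dimensional complement with `ℝ`, `O` is the pull-back of a small
ball around `(φ z₀, 0)` — small enough that, `f` being a topological embedding, `range f ∩ O` is
exactly the slice `{last coordinate = 0}` — and `H₁, H₂` are the images of its two convex open
halves (Lee, *Introduction to Smooth Manifolds*, 2nd ed., Thm. 5.8 (local slice criterion) with
Prop. 5.2).

This is the local input of every "a connected closed hypersurface locally separates" argument;
it was first proved in the tree inside the Summits helper
`Summits/SmoothPoincare4/SmoothPoincare4/Theorems/SymplecticOrigamiOrigamiRungStubSides.lean`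
(namespace `Summit.…OrigamiRung.PairRigidityEndgame`, which Literature files cannot import) and is
re-homed here verbatim for Literature-side users (the sides of a folded symplectic form,
`Literature/Geometry/Symplectic/FoldedFormSidesConnected.lean`).

## References

* J. M. Lee, *Introduction to Smooth Manifolds*, 2nd ed., GTM 218 (2013), Thm. 5.8, Prop. 5.2.
-/

noncomputable section

open scoped Manifold ContDiff Topology
open Set

namespace Literature.Geometry.Manifold

/-- Model space `ℝⁿ`. -/
local notation "𝔼" n:arg => EuclideanSpace ℝ (Fin n)

variable {n : ℕ} {S : Type*} [TopologicalSpace S] [ChartedSpace (𝔼 n) S]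
  {X : Type*} [TopologicalSpace X] [ChartedSpace (𝔼 (n + 1)) X] {f : S → X}

-- adapted (verbatim) from Summits/SmoothPoincare4/SmoothPoincare4/Theorems/
-- SymplecticOrigamiOrigamiRungStubSides.lean (`exists_local_sides`, seat of stub_sides)
/-- **The two local sides of a smoothly embedded hypersurface.**  Let `f : S → X` be a smooth
embedding of an `n`-manifold into an `(n+1)`-manifold (models `𝓡 n`, `𝓡 (n+1)`) and `z₀ ∈ S`.
There are an open neighbourhood `O` of `f z₀` and two preconnected subsets `H₁, H₂` of the
complement of `range f` such that `O ⊆ range f ∪ H₁ ∪ H₂` and every point of `range f ∩ O` lies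
in the closure of `H₁` and of `H₂`.  (In the slice charts `φ, ψ` of Mathlib's immersion data at
`z₀`, straightened by an identification of the one-dimensional complement with `ℝ`, `f` reads
`u ↦ (u, 0)`; `O` is the pull-back of a small ball around `(φ z₀, 0)` — small enough that, `f`
being a topological embedding, `range f ∩ O` is exactly the slice `{last coordinate = 0}` — and
`H₁, H₂` are the images of its two convex open halves.)
[cite: LeeSmoothManifolds2013, Thm. 5.8 and Prop. 5.2] -/
theorem exists_local_sides (hf : Manifold.IsSmoothEmbedding (𝓡 n) (𝓡 (n + 1)) ∞ f) (z₀ : S) :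
    ∃ O H₁ H₂ : Set X, IsOpen O ∧ f z₀ ∈ O ∧ IsPreconnected H₁ ∧ IsPreconnected H₂ ∧
      H₁ ⊆ (range f)ᶜ ∧ H₂ ⊆ (range f)ᶜ ∧ O ⊆ range f ∪ (H₁ ∪ H₂) ∧
      range f ∩ O ⊆ closure H₁ ∧ range f ∩ O ⊆ closure H₂ := by
  have hi : Manifold.IsImmersionAt (𝓡 n) (𝓡 (n + 1)) ∞ f z₀ := hf.isImmersion.isImmersionAt z₀
  -- the complement in the immersion data is a line; straighten `ℝⁿ⁺¹ ≃ ℝⁿ × ℝ`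
  haveI : FiniteDimensional ℝ hi.complement := by
    haveI : Module.Finite ℝ ((𝔼 n) × hi.complement) :=
      Module.Finite.equiv hi.equiv.toLinearEquiv.symm
    exact Module.Finite.of_injective (LinearMap.inr ℝ (𝔼 n) hi.complement) LinearMap.inr_injective
  have hrank : Module.finrank ℝ hi.complement = Module.finrank ℝ ℝ := by
    have h := hi.equiv.toLinearEquiv.finrank_eq
    rw [Module.finrank_prod, finrank_euclideanSpace_fin, finrank_euclideanSpace_fin] at h
    rw [Module.finrank_self]
    omega
  obtain ⟨T, hT⟩ : ∃ T : (𝔼 (n + 1)) ≃L[ℝ] (𝔼 n) × ℝ, ∀ a : 𝔼 n, T (hi.equiv (a, 0)) = (a, 0) := by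
    refine ⟨hi.equiv.symm.trans ((ContinuousLinearEquiv.refl ℝ (𝔼 n)).prodCongr
      (ContinuousLinearEquiv.ofFinrankEq hrank)), fun a => ?_⟩
    simp
  -- in the charts `φ = hi.domChart`, `ψ = hi.codChart`, `f` reads `z ↦ T.symm (φ z, 0)`
  have hTf : ∀ z ∈ hi.domChart.source, T (hi.codChart (f z)) = (hi.domChart z, 0) := by
    intro z hz
    have hmem : (hi.domChart.extend (𝓡 n)) z ∈ (hi.domChart.extend (𝓡 n)).target :=
      (hi.domChart.extend (𝓡 n)).map_source
        (by rw [OpenPartialHomeomorph.extend_source]; exact hz)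
    have hw := hi.writtenInCharts hmem
    simp only [Function.comp_apply] at hw
    rw [OpenPartialHomeomorph.extend_left_inv _ hz] at hw
    have h1 : (hi.codChart.extend (𝓡 (n + 1))) (f z) = hi.codChart (f z) := by
      rw [OpenPartialHomeomorph.extend_coe, Function.comp_apply, modelWithCornersSelf_coe, id]
    have h2 : (hi.domChart.extend (𝓡 n)) z = hi.domChart z := by
      rw [OpenPartialHomeomorph.extend_coe, Function.comp_apply, modelWithCornersSelf_coe, id]
    rw [h1, h2] at hw
    rw [hw, hT]
  -- an open set of `X` cutting out the source of the domain chart (`f` is an embedding)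
  obtain ⟨Wo, hWo, hWo_pre⟩ := hf.isEmbedding.isInducing.isOpen_iff.mp hi.domChart.open_source
  have hz₀φ : z₀ ∈ hi.domChart.source := hi.mem_domChart_source
  have hpψ : f z₀ ∈ hi.codChart.source := hi.mem_codChart_source
  -- the admissible region in straightened coordinates, and a ball inside it
  set G : Set ((𝔼 n) × ℝ) := T.symm ⁻¹' (hi.codChart.target ∩ hi.codChart.symm ⁻¹' Wo) ∩
    Prod.fst ⁻¹' hi.domChart.target with hG
  have hGo : IsOpen G :=
    ((hi.codChart.isOpen_inter_preimage_symm hWo).preimage T.symm.continuous).inter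
      (hi.domChart.open_target.preimage continuous_fst)
  have hG₀ : (hi.domChart z₀, (0 : ℝ)) ∈ G := by
    refine ⟨?_, hi.domChart.map_source hz₀φ⟩
    show T.symm (hi.domChart z₀, 0) ∈ hi.codChart.target ∩ hi.codChart.symm ⁻¹' Wo
    rw [← hTf z₀ hz₀φ, ContinuousLinearEquiv.symm_apply_apply]
    refine ⟨hi.codChart.map_source hpψ, ?_⟩
    rw [mem_preimage, hi.codChart.left_inv hpψ, ← mem_preimage, hWo_pre]
    exact hz₀φ
  obtain ⟨r, hr, hball⟩ := Metric.isOpen_iff.mp hGo _ hG₀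
  set Bx : Set ((𝔼 n) × ℝ) := Metric.ball (hi.domChart z₀, (0 : ℝ)) r with hBx
  have hBxo : IsOpen Bx := Metric.isOpen_ball
  have hBxt : ∀ q ∈ Bx, T.symm q ∈ hi.codChart.target := fun q hq => (hball hq).1.1
  -- the pull-back `g = ψ⁻¹ ∘ T⁻¹`, continuous on the ball
  set g : (𝔼 n) × ℝ → X := fun q => hi.codChart.symm (T.symm q) with hg
  have hgc : ContinuousOn g Bx :=
    hi.codChart.continuousOn_symm.comp T.symm.continuous.continuousOn hBxt
  -- the box `O`
  set O : Set X := {x | x ∈ hi.codChart.source ∧ T (hi.codChart x) ∈ Bx} with hO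
  have hOo : IsOpen O :=
    (T.continuous.comp_continuousOn hi.codChart.continuousOn).isOpen_inter_preimage
      hi.codChart.open_source hBxo
  have hOWo : O ⊆ Wo := by
    rintro x ⟨hx, hxB⟩
    have h1 := (hball hxB).1.2
    simp only [mem_preimage, ContinuousLinearEquiv.symm_apply_apply] at h1
    rwa [hi.codChart.left_inv hx] at h1
  have hgx : ∀ x ∈ O, g (T (hi.codChart x)) = x := fun x hx => by
    simp only [hg, ContinuousLinearEquiv.symm_apply_apply, hi.codChart.left_inv hx.1]
  have hTg : ∀ q ∈ Bx, T (hi.codChart (g q)) = q := fun q hq => by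
    simp only [hg, hi.codChart.right_inv (hBxt q hq), ContinuousLinearEquiv.apply_symm_apply]
  have hgO : ∀ q ∈ Bx, g q ∈ O := fun q hq =>
    ⟨hi.codChart.map_target (hBxt q hq), by rw [hTg q hq]; exact hq⟩
  -- inside the box, `range f` is exactly the slice `{q.2 = 0}`
  have hslice : ∀ q ∈ Bx, g q ∈ range f → q.2 = 0 := by
    rintro q hq ⟨z, hz⟩
    have hzφ : z ∈ hi.domChart.source := by
      rw [← hWo_pre]
      exact hOWo (hz ▸ hgO q hq)
    have h := hTf z hzφ
    rw [hz, hTg q hq] at h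
    rw [h]
  have hslice' : ∀ x ∈ O, (T (hi.codChart x)).2 = 0 → x ∈ range f := by
    intro x hx h0
    have ha : (T (hi.codChart x)).1 ∈ hi.domChart.target := (hball hx.2).2
    have hzs : hi.domChart.symm (T (hi.codChart x)).1 ∈ hi.domChart.source :=
      hi.domChart.map_target ha
    refine ⟨hi.domChart.symm (T (hi.codChart x)).1, ?_⟩
    have hfz : f (hi.domChart.symm (T (hi.codChart x)).1) ∈ hi.codChart.source :=
      hi.source_subset_preimage_source hzs
    have hTz :
        T (hi.codChart (f (hi.domChart.symm (T (hi.codChart x)).1))) = T (hi.codChart x) := by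
      rw [hTf _ hzs, hi.domChart.right_inv ha]
      exact Prod.ext rfl h0.symm
    exact hi.codChart.injOn hfz hx.1 (T.injective hTz)
  -- the half-boxes over a convex `s ⊆ ℝ` missing `0` but adherent to it
  have key : ∀ s : Set ℝ, Convex ℝ s → (0 : ℝ) ∉ s → (0 : ℝ) ∈ closure s →
      IsPreconnected (g '' (Bx ∩ Prod.snd ⁻¹' s)) ∧ g '' (Bx ∩ Prod.snd ⁻¹' s) ⊆ (range f)ᶜ ∧
        range f ∩ O ⊆ closure (g '' (Bx ∩ Prod.snd ⁻¹' s)) := by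
    intro s hs h0 h0c
    refine ⟨?_, ?_, ?_⟩
    · exact ((convex_ball _ _).inter
        (hs.linear_preimage (LinearMap.snd ℝ (𝔼 n) ℝ))).isPreconnected.image _
          (hgc.mono inter_subset_left)
    · rintro _ ⟨q, ⟨hqB, hqs⟩, rfl⟩ hmem
      exact h0 (hslice q hqB hmem ▸ hqs)
    · rintro x ⟨hxr, hxO⟩
      have hq0 : (T (hi.codChart x)).2 = 0 := hslice _ hxO.2 ((hgx x hxO).symm ▸ hxr)
      have hqc : T (hi.codChart x) ∈ closure (Bx ∩ Prod.snd ⁻¹' s) := by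
        refine hBxo.inter_closure ⟨hxO.2, ?_⟩
        refine isOpenMap_snd.preimage_closure_subset_closure_preimage ?_
        rw [mem_preimage, hq0]
        exact h0c
      rw [← hgx x hxO]
      exact ((hgc.continuousWithinAt hxO.2).mono inter_subset_left).mem_closure_image hqc
  obtain ⟨hc₁, hr₁, hcl₁⟩ := key (Ioi 0) (convex_Ioi 0) (fun h => lt_irrefl (0 : ℝ) h)
    (by rw [closure_Ioi]; exact mem_Ici.2 le_rfl)
  obtain ⟨hc₂, hr₂, hcl₂⟩ := key (Iio 0) (convex_Iio 0) (fun h => lt_irrefl (0 : ℝ) h)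
    (by rw [closure_Iio]; exact mem_Iic.2 le_rfl)
  refine ⟨O, _, _, hOo, ⟨hpψ, by rw [hTf z₀ hz₀φ]; exact Metric.mem_ball_self hr⟩, hc₁, hc₂,
    hr₁, hr₂, fun x hx => ?_, hcl₁, hcl₂⟩
  -- `O ⊆ range f ∪ (H₁ ∪ H₂)`
  by_cases hxr : x ∈ range f
  · exact Or.inl hxr
  have hne : (T (hi.codChart x)).2 ≠ 0 := fun h => hxr (hslice' x hx h)
  rcases hne.lt_or_gt with hneg | hpos
  · exact Or.inr (Or.inr ⟨T (hi.codChart x), ⟨hx.2, hneg⟩, hgx x hx⟩)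
  · exact Or.inr (Or.inl ⟨T (hi.codChart x), ⟨hx.2, hpos⟩, hgx x hx⟩)


end Literature.Geometry.Manifold

end
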